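import Mathlib
import Literature.Geometry.Lorentzian.ReggeWheelerChannels
import Summits.FinalStateConjecture.FinalStateConjecture.Theorems.PhotonSphereChannelsCauchyWaveGlobal
import Summits.FinalStateConjecture.FinalStateConjecture.Theorems.PhotonSphereChannelsBlindnessWaveEnergyBounds
import Summits.FinalStateConjecture.FinalStateConjecture.Theorems.PhotonSphereChannelsFrozenPacketAnsatz
import Summits.FinalStateConjecture.FinalStateConjecture.Theorems.PhotonSphereChannelsWindowedShellChannelsStubParity
import Summits.FinalStateConjecture.FinalStateConjecture.Theorems.WindowedShellChannels.Negative.LaggedApertures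

/-!
# `WindowedShellChannels` (stmt-FinalStateConjecture-14085), the logarithmic lag law — II: a
# solution that starts as a cut Gaussian beam has small exterior energy while the beam sits inside
# the lagged ball

Support file (prover seat 1; everything proved, no definitions). The energy step of the
logarithmic lag law, abstracted from the beam: let `G(t, x)` be a `C²` field supported in the
moving slab `|x − X(t)| < δ₀` around a curve `X` with `|X(t) − X(0)| ≤ |t|`, with
`∂_t G(0, ·) = 0` and whose residual `PG = G_tt − G_xx + VG` has `∫(PG)² ≤ N₂` on `[0, T]` (for the
cut first-order Gaussian beam: `N₂ = 2δ₀B²μ`, `Literature.Analysis.PDE.cutBeam_residual_pointwise`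
and `…integral_sq_le_of_bound`). If `ψ` is ANY global `C²` solution of `ψ_tt − ψ_xx + Vψ = 0` with
the same Cauchy data `(G(0,·), 0)`, then at every time `t ∈ [0, T]` and for every aperture `a`
whose exterior region `{a + |t| < |x − xc|}` misses the slab `{|x − X t| ≤ δ₀}`,

  `E_ext[ψ](t) ≤ (e − 1) T² N₂`                                  (`exteriorEnergy_le_of_beam`).

Proof: the error field `φ = ψ − G` is `C²`, has zero data, is supported in
`[X(0) − δ₀ − |t|, X(0) + δ₀ + |t|]` (domain of dependence for `ψ`,
`CauchyWaveGlobal.curried_eq_zero_of_data`; the slab for `G`), and `Pφ = −PG`; the energy inequality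
with forcing `Blindness.energy_le_of_forcing` bounds its energy by `(e−1)T²N₂`; on the exterior
region `G ≡ 0` near every point, so `ψ` and `φ` have the same energy density there. The second
lemma `channelEnergy_atBot_eq_reflect` (time reversal) lets the same bound serve the backward
channel, since the data `(G(0,·), 0)` are even.
-/

noncomputable section

-- every `Summit.FinalStateConjecture.FinalStateConjecture.…` name repeats the summit = sub-problem
-- segment (D-0017 layout), as in every landed `…Theorems` file of this route
set_option linter.dupNamespace false

namespace Summit.FinalStateConjecture.FinalStateConjecture.Theorems.LagLaw

open Literature.Geometry.Lorentzian Literature.Geometry.Lorentzian.ReggeWheeler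
open Summit.FinalStateConjecture.FinalStateConjecture.Theorems
open MeasureTheory Set Filter Topology Function
open scoped ENNReal

/-! ### Slices of functions agreeing near a point -/

/-- If two functions of `(t, x)` agree near `(t, x)`, their energy densities agree at `(t, x)`. -/
theorem energyDensity_congr_of_eventuallyEq {V : ℝ → ℝ} {ψ φ : ℝ → ℝ → ℝ} {t x : ℝ}
    (h : uncurry ψ =ᶠ[𝓝 (t, x)] uncurry φ) :
    energyDensity V ψ t x = energyDensity V φ t x := by
  have ht : (fun τ => ψ τ x) =ᶠ[𝓝 t] fun τ => φ τ x := by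
    have hc : Continuous fun τ : ℝ => (τ, x) := Continuous.prodMk_left x
    exact hc.continuousAt.tendsto.eventually h |>.mono fun τ hτ => hτ
  have hx : ψ t =ᶠ[𝓝 x] φ t := by
    have hc : Continuous fun y : ℝ => (t, y) := Continuous.prodMk_right t
    exact hc.continuousAt.tendsto.eventually h |>.mono fun y hy => hy
  have hv : ψ t x = φ t x := h.self_of_nhds
  unfold energyDensity
  rw [ht.deriv_eq, hx.deriv_eq, hv]

/-! ### The energy step -/

/-- **Exterior energy of a solution that starts as a (cut) beam.** See the module docstring. -/
theorem exteriorEnergy_le_of_beam {V : ℝ → ℝ} {G ψ : ℝ → ℝ → ℝ} {X : ℝ → ℝ} {δ₀ T N2 : ℝ}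
    (hV : ContDiff ℝ 1 V) (hV0 : ∀ x, 0 ≤ V x)
    (hG : ContDiff ℝ 2 (uncurry G)) (hXc : Continuous X) (hXlip : ∀ t, |X t - X 0| ≤ |t|)
    (hG0 : ∀ t x, δ₀ ≤ |x - X t| → G t x = 0) (hGt0 : ∀ x, deriv (fun τ => G τ x) 0 = 0)
    (hδ : 0 < δ₀) (hT : 0 < T) (hN2 : 0 ≤ N2)
    (hres : ∀ t ∈ Icc 0 T, ∫ x, (iteratedDeriv 2 (fun τ => G τ x) t - iteratedDeriv 2 (G t) x
      + V x * G t x) ^ 2 ≤ N2)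
    (hψ : IsSolution V ψ) (hd0 : ∀ x, ψ 0 x = G 0 x) (hd1 : ∀ x, deriv (fun τ => ψ τ x) 0 = 0)
    {xc a t : ℝ} (ht : t ∈ Icc 0 T) (hball : ∀ x, a + |t| < |x - xc| → δ₀ < |x - X t|) :
    exteriorEnergy V xc a ψ t ≤ ENNReal.ofReal ((Real.exp 1 - 1) * T ^ 2 * N2) := by
  have hVd : Differentiable ℝ V := hV.differentiable one_ne_zero
  set φ : ℝ → ℝ → ℝ := fun t x => ψ t x - G t x with hφdef
  have hφC : ContDiff ℝ 2 (uncurry φ) := hψ.1.sub hG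
  -- support of `φ`
  set α : ℝ := X 0 - δ₀ with hα
  set β : ℝ := X 0 + δ₀ with hβ
  have hG0' : ∀ τ y, (y < α - |τ| ∨ β + |τ| < y) → G τ y = 0 := by
    intro τ y hy
    apply hG0
    obtain ⟨hX1, hX2⟩ := abs_le.mp (hXlip τ)
    have hτ := abs_nonneg τ
    rcases hy with hy | hy
    · rw [abs_of_neg (by linarith)]; linarith
    · rw [abs_of_pos (by linarith)]; linarith
  have hdata0 : ∀ y, (y ≤ α ∨ β ≤ y) → ψ 0 y = 0 := by
    intro y hy
    rw [hd0]
    apply hG0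
    rcases hy with hy | hy
    · rw [abs_of_nonpos (by linarith)]; linarith
    · rw [abs_of_nonneg (by linarith)]; linarith
  have hψ0' : ∀ τ y, (y < α - |τ| ∨ β + |τ| < y) → ψ τ y = 0 := by
    intro τ y hy
    rcases hy with hy | hy
    · -- data vanish on `[y − |τ|, α]`
      refine CauchyWaveGlobal.curried_eq_zero_of_data hVd hV0 hψ (a := y - |τ|) (b := α)
        (fun z hz => hdata0 z (Or.inl hz.2)) (fun z _ => hd1 z) (by linarith) (by linarith)
    · refine CauchyWaveGlobal.curried_eq_zero_of_data hVd hV0 hψ (a := β) (b := y + |τ|)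
        (fun z hz => hdata0 z (Or.inr hz.1)) (fun z _ => hd1 z) (by linarith) (by linarith)
  have hφsupp : ∀ τ y, (y < α - |τ| ∨ β + |τ| < y) → φ τ y = 0 := fun τ y hy => by
    simp only [hφdef, hψ0' τ y hy, hG0' τ y hy, sub_zero]
  -- zero data
  have hφ0 : ∀ y, φ 0 y = 0 := fun y => by simp only [hφdef, hd0, sub_self]
  have hφ1 : ∀ y, deriv (fun τ => φ τ y) 0 = 0 := by
    intro y
    have h1 : DifferentiableAt ℝ (fun τ => ψ τ y) 0 :=
      ((hψ.1.comp (contDiff_id.prodMk contDiff_const)).differentiable two_ne_zero) 0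
    have h2 : DifferentiableAt ℝ (fun τ => G τ y) 0 :=
      ((hG.comp (contDiff_id.prodMk contDiff_const)).differentiable two_ne_zero) 0
    simp only [hφdef]
    rw [deriv_fun_sub h1 h2, hd1, hGt0, sub_zero]
  -- the residual of `φ` is minus that of `G`
  have hres' : ∀ s ∈ Icc 0 T, ∫ x, (iteratedDeriv 2 (fun τ => φ τ x) s - iteratedDeriv 2 (φ s) x
      + V x * φ s x) ^ 2 ≤ N2 := by
    intro s hs
    have heq : ∀ x, iteratedDeriv 2 (fun τ => φ τ x) s - iteratedDeriv 2 (φ s) x + V x * φ s x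
        = -(iteratedDeriv 2 (fun τ => G τ x) s - iteratedDeriv 2 (G s) x + V x * G s x) := by
      intro x
      have c1 : ContDiff ℝ 2 fun τ => ψ τ x := hψ.1.comp (contDiff_id.prodMk contDiff_const)
      have c2 : ContDiff ℝ 2 fun τ => G τ x := hG.comp (contDiff_id.prodMk contDiff_const)
      have c3 : ContDiff ℝ 2 fun y => ψ s y := hψ.1.comp (contDiff_const.prodMk contDiff_id)
      have c4 : ContDiff ℝ 2 fun y => G s y := hG.comp (contDiff_const.prodMk contDiff_id)
      have e1 : iteratedDeriv 2 (fun τ => φ τ x) s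
          = iteratedDeriv 2 (fun τ => ψ τ x) s - iteratedDeriv 2 (fun τ => G τ x) s := by
        simp only [hφdef]
        rw [iteratedDeriv_fun_sub c1.contDiffAt c2.contDiffAt]
      have e2 : iteratedDeriv 2 (φ s) x = iteratedDeriv 2 (ψ s) x - iteratedDeriv 2 (G s) x := by
        have : φ s = fun y => ψ s y - G s y := rfl
        rw [this, iteratedDeriv_fun_sub c3.contDiffAt c4.contDiffAt]
      have hsol := hψ.2 (s, x)
      unfold IsSolutionAt at hsol
      simp only at hsol
      rw [e1, e2]
      simp only [hφdef]
      linear_combination hsol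
    simp_rw [heq, neg_sq]
    exact hres s hs
  -- the energy inequality with forcing
  have hE := Blindness.energy_le_of_forcing hφC hV hV0 hφsupp hφ0 hφ1 hT hN2 hres' t ht
  -- on the exterior region `ψ` and `φ` have the same energy density
  have hcongr : ∀ x, a + |t| < |x - xc| → energyDensity V ψ t x = energyDensity V φ t x := by
    intro x hx
    apply energyDensity_congr_of_eventuallyEq
    have hopen : IsOpen {p : ℝ × ℝ | δ₀ < |p.2 - X p.1|} :=
      isOpen_lt continuous_const ((continuous_snd.sub (hXc.comp continuous_fst)).abs)
    filter_upwards [hopen.mem_nhds (hball x hx)] with p hp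
    simp only [uncurry, hφdef, hG0 p.1 p.2 hp.le, sub_zero]
  -- conclusion
  have hint : Integrable fun x => energyDensity V φ t x :=
    FrozenPacket.integrable_energyDensity hV.continuous hφC hφsupp t
  calc exteriorEnergy V xc a ψ t
      = ∫⁻ x in {x | a + |t| < |x - xc|}, ENNReal.ofReal (energyDensity V φ t x) := by
        unfold exteriorEnergy
        refine setLIntegral_congr_fun (measurableSet_lt measurable_const
          ((measurable_id.sub_const xc).abs)) ?_
        exact fun x hx => by rw [hcongr x hx]
    _ ≤ ∫⁻ x, ENNReal.ofReal (energyDensity V φ t x) := setLIntegral_le_lintegral _ _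
    _ = ENNReal.ofReal (∫ x, energyDensity V φ t x) := by
        rw [ofReal_integral_eq_lintegral_ofReal hint
          (Eventually.of_forall fun x => energyDensity_nonneg φ t (hV0 x))]
    _ ≤ ENNReal.ofReal ((Real.exp 1 - 1) * T ^ 2 * N2) := ENNReal.ofReal_le_ofReal hE

/-! ### Time reversal and the two channels -/

/-- The backward channel energy of `ψ` is the forward channel energy of the time-reflected field
`ψ̃(t, x) = ψ(−t, x)` (written as the parity combination `0·ψ(t,x) + 1·ψ(−t,x)` of
`WindowedShellChannelsStubs.Parity`). -/
theorem channelEnergy_atBot_eq_reflect {V : ℝ → ℝ} {ψ : ℝ → ℝ → ℝ}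
    (hψ : ContDiff ℝ 2 (uncurry ψ)) (xc a : ℝ) :
    channelEnergy V xc a ψ atBot
      = channelEnergy V xc a (fun t x => 0 * ψ t x + 1 * ψ (-t) x) atTop := by
  have hfun : exteriorEnergy V xc a ψ
      = exteriorEnergy V xc a (fun t x => 0 * ψ t x + 1 * ψ (-t) x) ∘ Neg.neg := by
    funext t
    rw [Function.comp_apply, WindowedShellChannelsStubs.Parity.exteriorEnergy_reflect hψ, neg_neg]
  unfold channelEnergy
  rw [hfun, Filter.liminf_comp, Filter.map_neg_atBot]

/-- The time-reflected field has the same Cauchy data as `ψ` when `∂_t ψ(0, ·) = 0`. -/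
theorem reflect_data {ψ : ℝ → ℝ → ℝ} (hψ : ContDiff ℝ 2 (uncurry ψ))
    (hd1 : ∀ x, deriv (fun τ => ψ τ x) 0 = 0) :
    (∀ x, (fun t x => 0 * ψ t x + 1 * ψ (-t) x) 0 x = ψ 0 x) ∧
      ∀ x, deriv (fun τ => 0 * ψ τ x + 1 * ψ (-τ) x) 0 = 0 := by
  refine ⟨fun x => by simp only [neg_zero, zero_mul, one_mul, zero_add], fun x => ?_⟩
  rw [WindowedShellChannelsStubs.Parity.deriv_comb_fst hψ 0 1 0 x, neg_zero, hd1]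
  ring

/-- **Both channels of a solution that starts as a (cut) rest beam are small.** Under the
hypotheses of `exteriorEnergy_le_of_beam` on the beam `G` (slab support around `X`, `∂_t G(0,·) = 0`,
residual bound `N₂` on `[0, T]`), every global `C²` solution `ψ` with data `(G(0,·), 0)` has
`ch⁺ + ch⁻ ≤ 2 (e − 1) T² N₂` for every aperture `a` with `0 ≤ a + T` whose exterior region at
time `T` misses the slab. The forward channel is at most the exterior energy at time `T`
(`Negative.channelEnergy_atTop_le_exteriorEnergy`); the backward channel is the forward channel of
the reflected field, which solves the same equation with the same data. -/
theorem channelEnergy_add_le_of_beam {V : ℝ → ℝ} {G ψ : ℝ → ℝ → ℝ} {X : ℝ → ℝ} {δ₀ T N2 : ℝ}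
    (hV : ContDiff ℝ 1 V) (hV0 : ∀ x, 0 ≤ V x)
    (hG : ContDiff ℝ 2 (uncurry G)) (hXc : Continuous X) (hXlip : ∀ t, |X t - X 0| ≤ |t|)
    (hG0 : ∀ t x, δ₀ ≤ |x - X t| → G t x = 0) (hGt0 : ∀ x, deriv (fun τ => G τ x) 0 = 0)
    (hδ : 0 < δ₀) (hT : 0 < T) (hN2 : 0 ≤ N2)
    (hres : ∀ t ∈ Icc 0 T, ∫ x, (iteratedDeriv 2 (fun τ => G τ x) t - iteratedDeriv 2 (G t) x
      + V x * G t x) ^ 2 ≤ N2)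
    (hψ : IsSolution V ψ) (hd0 : ∀ x, ψ 0 x = G 0 x) (hd1 : ∀ x, deriv (fun τ => ψ τ x) 0 = 0)
    {xc a : ℝ} (ha : 0 ≤ a + T) (hball : ∀ x, a + |T| < |x - xc| → δ₀ < |x - X T|) :
    channelEnergy V xc a ψ atTop + channelEnergy V xc a ψ atBot
      ≤ 2 * ENNReal.ofReal ((Real.exp 1 - 1) * T ^ 2 * N2) := by
  have hVd : Differentiable ℝ V := hV.differentiable one_ne_zero
  have hTm : T ∈ Icc 0 T := ⟨hT.le, le_rfl⟩
  -- forward channel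
  have h1 : channelEnergy V xc a ψ atTop ≤ ENNReal.ofReal ((Real.exp 1 - 1) * T ^ 2 * N2) :=
    (WindowedShellChannels.Negative.channelEnergy_atTop_le_exteriorEnergy hVd hV0 hψ xc a hT.le
      ha).trans (exteriorEnergy_le_of_beam hV hV0 hG hXc hXlip hG0 hGt0 hδ hT hN2 hres hψ hd0 hd1
      hTm hball)
  -- backward channel, via the reflected field
  set ψr : ℝ → ℝ → ℝ := fun t x => 0 * ψ t x + 1 * ψ (-t) x with hψr
  have hψr_sol : IsSolution V ψr := WindowedShellChannelsStubs.Parity.isSolution_comb hψ 0 1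
  obtain ⟨hr0, hr1⟩ := reflect_data hψ.1 hd1
  have h2 : channelEnergy V xc a ψ atBot ≤ ENNReal.ofReal ((Real.exp 1 - 1) * T ^ 2 * N2) := by
    rw [channelEnergy_atBot_eq_reflect hψ.1 xc a]
    exact (WindowedShellChannels.Negative.channelEnergy_atTop_le_exteriorEnergy hVd hV0 hψr_sol xc
      a hT.le ha).trans (exteriorEnergy_le_of_beam hV hV0 hG hXc hXlip hG0 hGt0 hδ hT hN2 hres
      hψr_sol (fun x => (hr0 x).trans (hd0 x)) hr1 hTm hball)
  calc channelEnergy V xc a ψ atTop + channelEnergy V xc a ψ atBot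
      ≤ ENNReal.ofReal ((Real.exp 1 - 1) * T ^ 2 * N2)
        + ENNReal.ofReal ((Real.exp 1 - 1) * T ^ 2 * N2) := add_le_add h1 h2
    _ = 2 * ENNReal.ofReal ((Real.exp 1 - 1) * T ^ 2 * N2) := by rw [two_mul]

/-- **Registered sub-goal `stub_lagLawPacket` of stmt-FinalStateConjecture-14085** (seat 1, the
logarithmic lag law): the two-channel smallness of a solution that starts as a cut rest beam,
bundled with explicit binders. -/
theorem stub_lagLawPacket : ∀ (V : ℝ → ℝ) (G ψ : ℝ → ℝ → ℝ) (X : ℝ → ℝ) (δ₀ T N2 xc a : ℝ), ContDiff ℝ 1 V → (∀ x, 0 ≤ V x) → ContDiff ℝ 2 (Function.uncurry G) → Continuous X → (∀ t, |X t - X 0| ≤ |t|) → (∀ t x, δ₀ ≤ |x - X t| → G t x = 0) → (∀ x, deriv (fun τ => G τ x) 0 = 0) → 0 < δ₀ → 0 < T → 0 ≤ N2 → (∀ t ∈ Set.Icc 0 T, ∫ x, (iteratedDeriv 2 (fun τ => G τ x) t - iteratedDeriv 2 (G t) x + V x * G t x) ^ 2 ≤ N2) → IsSolution V ψ → (∀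 x, ψ 0 x = G 0 x) → (∀ x, deriv (fun τ => ψ τ x) 0 = 0) → 0 ≤ a + T → (∀ x, a + |T| < |x - xc| → δ₀ < |x - X T|) → channelEnergy V xc a ψ Filter.atTop + channelEnergy V xc a ψ Filter.atBot ≤ 2 * ENNReal.ofReal ((Real.exp 1 - 1) * T ^ 2 * N2) := by
  intro V G ψ X δ₀ T N2 xc a hV hV0 hG hXc hXlip hG0 hGt0 hδ hT hN2 hres hψ hd0 hd1 ha hball
  exact channelEnergy_add_le_of_beam hV hV0 hG hXc hXlip hG0 hGt0 hδ hT hN2 hres hψ hd0 hd1 ha hball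

end Summit.FinalStateConjecture.FinalStateConjecture.Theorems.LagLaw
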